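import Summits.QuantumFields.YangMills.Theorems.SwapVirialDeficitZeroModeSigmaFourSmallBallTaylor
import HarnessLib

/-!
# Exact zero-mode rung Z5 — the σ-TWISTED FOUR-LEADER small ball, VIII: the linearised relations at an axial hub
# (deterministic side of the RATE; w2 g56's request 11:05:54Z «ratios ≤ c·r∕(A.imI·…) on limSigma r A»; free-hands support of ⟨stmt-QuantumFields-24197⟩)

For an axial unit hub `A = α + βi` (`A.imJ = A.imK = 0`, `‖A‖ = 1`) and `z₀ > 0` the six derivatives `L_i = Lrel A x y z i` of part III-a are
EXPLICIT in the letter derivatives `Xd x = ‖x̄‖⁻¹·x_⊥`, `Xd y`, `Zd z = |z₀|⁻¹·ζ` (part VII):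
* §41 `axial_mul_transversal` (`A·v = v·Ā` for transversal `v ∈ span{j,k}`), ★ `norm_axial_comm_transversal` (`‖Av − vA‖ = 2|β|‖v‖`),
  `norm_star_sub_cube` (`‖Ā − A³‖ = 4|αβ|`); ★ `Lrel_three_eq` (`L₃ = A·ν(x̄)·Zd z`, so `‖L₃‖ = c`), ★ `norm_Lrel_five` (`‖L₅‖ = 2|β|·b`),
  ★ `Lrel_four_eq` (`L₄ = Xd x·(Ā − A³) − ν(x̄)·Zd z·A`, so `4|αβ|·a ≤ ‖L₄‖ + c`);
* §42 ★★ `ratios_le_of_mem_limSigma`: on `limSigma r A` (with `x̄ ≠ 0`): `c ≤ r`, `2|β|·b ≤ r`, `4|αβ|·a ≤ 2r`; ★★ `sum_ratios_le_of_mem_limSigma`: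
  `a + b + c ≤ 2r/|αβ|` — the `L`-side region `{a + b + c > R₀} ∩ limSigma r A` is EMPTY for `R₀ ≥ 2r/|αβ|` (hub weight `|αβ|⁻¹`, both caps).
HONEST LABEL: deterministic finite-dimensional algebra (plan-level zero-mode rung of the DRAFT line «sharp-sigma»); no rate is proved here; NOT ⟨24197⟩;
own crux ⟨22884⟩ OPEN (blocked-on ⟨19935⟩); the Yang–Mills mass gap is NOT proved; no summit is proved by a line.
Width seat ym-line-sfw-p2-w3 g63 (cell ym-idea-1, free hands), `--supports stmt-QuantumFields-24197`.  THEOREMS ONLY, standard axioms, 0 `sorry`.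
References: [cite: GonzalezarroyoAltes1988]; [cite: Vanbaal2001]; [cite: Luscher1983, §2]; [folklore].
-/

set_option autoImplicit false

noncomputable section

open Quaternion Set
open scoped Quaternion RealInnerProductSpace
open Literature.MathematicalPhysics.QuantumLattice
open Literature.Analysis.Calculus (radialUnit radialUnit_def norm_radialUnit tangentialProj tangentialProj_apply tangentialProj_eq_self)
open Summit.QuantumFields.YangMills.Theorems.SwapTwistDeficit.ToronLog
open Summit.QuantumFields.YangMills.Theorems.SwapVirialDeficit.ZeroModeGroup

namespace Summit.QuantumFields.YangMills.Theorems.SwapVirialDeficit.ZeroModeSigma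

/-! ## §41 The linearised relations at an axial hub: exact norms, and the ratio bounds on the limit event (w2 g56's request 11:05Z) -/

/-- An axial element times a transversal one: `A·v = v·Ā` (`A ∈ span{1, i}`, `v ∈ span{j, k}`). [folklore] -/
theorem axial_mul_transversal {A v : ℍ} (hJ : A.imJ = 0) (hK : A.imK = 0) (hv : v.re = 0) (hvI : v.imI = 0) : A * v = v * star A := by
  ext <;> simp [hJ, hK, hv, hvI] <;> ring

/-- ★ **The commutator of an axial and a transversal element has norm `2|A_i|·‖v‖`.** [folklore] -/
theorem norm_axial_comm_transversal {A v : ℍ} (hJ : A.imJ = 0) (hK : A.imK = 0) (hv : v.re = 0) (hvI : v.imI = 0) :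
    ‖A * v - v * A‖ = 2 * |A.imI| * ‖v‖ := by
  have e1 : (A * v - v * A).re = 0 := by simp [hJ, hK, hv, hvI]
  have e2 : (A * v - v * A).imI = 0 := by simp [hJ, hK, hv, hvI]
  have e3 : (A * v - v * A).imJ = -(2 * A.imI * v.imK) := by simp [hJ, hK, hv, hvI]; ring
  have e4 : (A * v - v * A).imK = 2 * A.imI * v.imJ := by simp [hJ, hK, hv, hvI]; ring
  have hv2 : ‖v‖ ^ 2 = v.imJ ^ 2 + v.imK ^ 2 := by rw [sq_norm_eq_sum_sq, hv, hvI]; ring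
  have h : ‖A * v - v * A‖ ^ 2 = (2 * |A.imI| * ‖v‖) ^ 2 := by
    rw [sq_norm_eq_sum_sq, e1, e2, e3, e4, show (2 * |A.imI| * ‖v‖) ^ 2 = 4 * |A.imI| ^ 2 * ‖v‖ ^ 2 by ring, sq_abs, hv2]; ring
  exact (pow_left_inj₀ (norm_nonneg _) (by positivity) two_ne_zero).1 h

/-- For an axial unit `A = α + βi`: `Ā − A³ = 4αβ·(β − αi)`, of norm `4|αβ|`. [folklore] -/
theorem norm_star_sub_cube {A : ℍ} (hA : ‖A‖ = 1) (hJ : A.imJ = 0) (hK : A.imK = 0) : ‖star A - A * A * A‖ = 4 * |A.re * A.imI| := by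
  have h1 := axial_sq_add_sq hA hJ hK
  have e1 : (star A - A * A * A).re = 4 * A.re * A.imI ^ 2 := by
    simp [hJ, hK]; linear_combination (-A.re) * h1
  have e2 : (star A - A * A * A).imI = -(4 * A.re ^ 2 * A.imI) := by
    simp [hJ, hK]; linear_combination A.imI * h1
  have e3 : (star A - A * A * A).imJ = 0 := by simp [hJ, hK]
  have e4 : (star A - A * A * A).imK = 0 := by simp [hJ, hK]
  have h : ‖star A - A * A * A‖ ^ 2 = (4 * |A.re * A.imI|) ^ 2 := by
    rw [sq_norm_eq_sum_sq, e1, e2, e3, e4, show (4 * |A.re * A.imI|) ^ 2 = 16 * |A.re * A.imI| ^ 2 by ring, sq_abs]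
    linear_combination (16 * A.re ^ 2 * A.imI ^ 2) * h1
  exact (pow_left_inj₀ (norm_nonneg _) (by positivity) two_ne_zero).1 h

/-- The letter derivatives are transversal: `(Xd x).re = (Xd x).imI = 0`. [folklore] -/
theorem Xd_transversal (x : ℍ) : (Xd x).re = 0 ∧ (Xd x).imI = 0 := by
  rw [Xd_eq]; simp [trPart]

/-- For `z₀ > 0` and an axial unit hub: `Wd = Ā·Xd x·A + ν(x̄)·Zd z`. [folklore] -/
theorem Wd_eq_of_pos {A : ℍ} (hA : ‖A‖ = 1) (hJ : A.imJ = 0) (hK : A.imK = 0) (x : ℍ) {z : ℍ} (hz : 0 < z.re) :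
    Wd A x z = star A * Xd x * A + radialUnit (axPart x) * Zd z := by
  rw [Wd, radialUnit_coe_of_pos hz, mul_one, conj_radialUnit_axPart hA hJ hK]

/-- ★ **`L₃ = A·ν(x̄)·Zd z`** (`z₀ > 0`, axial unit hub): the first seam relation linearises to the slaved-letter derivative alone. [folklore] -/
theorem Lrel_three_eq {A : ℍ} (hA : ‖A‖ = 1) (hJ : A.imJ = 0) (hK : A.imK = 0) (x y : ℍ) {z : ℍ} (hz : 0 < z.re) :
    Lrel A x y z 3 = A * radialUnit (axPart x) * Zd z := by
  show A * Wd A x z - Xd x * A = _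
  have hAA : A * star A = 1 := by
    rw [Quaternion.self_mul_star, Quaternion.normSq_eq_norm_mul_self, hA, mul_one, Quaternion.coe_one]
  rw [Wd_eq_of_pos hA hJ hK x hz, mul_add, ← mul_assoc, ← mul_assoc, hAA, one_mul, ← mul_assoc]
  abel

/-- ★ **`‖L₃‖ = ‖Zd z‖ = c`** (`z₀ > 0`, `x̄ ≠ 0`, axial unit hub). [folklore] -/
theorem norm_Lrel_three {A : ℍ} (hA : ‖A‖ = 1) (hJ : A.imJ = 0) (hK : A.imK = 0) {x : ℍ} (hx : axPart x ≠ 0) (y : ℍ) {z : ℍ} (hz : 0 < z.re) :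
    ‖Lrel A x y z 3‖ = imRatio z := by
  rw [Lrel_three_eq hA hJ hK x y hz, norm_mul, norm_mul, hA, norm_radialUnit hx, one_mul, one_mul, norm_Zd]

/-- ★ **`‖L₅‖ = 2|A_i|·b`** (axial hub): the conjugation relation of the second pair letter linearises to a pure commutator. [folklore] -/
theorem norm_Lrel_five {A : ℍ} (hJ : A.imJ = 0) (hK : A.imK = 0) (x y z : ℍ) : ‖Lrel A x y z 5‖ = 2 * |A.imI| * trRatio y := by
  show ‖A * Xd y - Xd y * A‖ = _
  rw [norm_axial_comm_transversal hJ hK (Xd_transversal y).1 (Xd_transversal y).2, norm_Xd]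

/-- ★ **`L₄ = Xd x·(Ā − A³) − ν(x̄)·Zd z·A`** (`z₀ > 0`, axial unit hub). [folklore] -/
theorem Lrel_four_eq {A : ℍ} (hA : ‖A‖ = 1) (hJ : A.imJ = 0) (hK : A.imK = 0) (x y : ℍ) {z : ℍ} (hz : 0 < z.re) :
    Lrel A x y z 4 = Xd x * (star A - A * A * A) - radialUnit (axPart x) * Zd z * A := by
  show A * Xd x - Wd A x z * A = _
  obtain ⟨h0, hI⟩ := Xd_transversal x
  have h1 : A * Xd x = Xd x * star A := axial_mul_transversal hJ hK h0 hI
  have h2 : star A * Xd x = Xd x * A := by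
    have := axial_mul_transversal (A := star A) (by simp [hJ]) (by simp [hK]) h0 hI
    rwa [star_star] at this
  rw [Wd_eq_of_pos hA hJ hK x hz, add_mul, h1, h2]
  noncomm_ring

/-- ★ **`4|αβ|·a ≤ ‖L₄‖ + c`** (`z₀ > 0`, `x̄ ≠ 0`, axial unit hub `A = α + βi`). [folklore] -/
theorem trRatio_mul_le_norm_Lrel_four {A : ℍ} (hA : ‖A‖ = 1) (hJ : A.imJ = 0) (hK : A.imK = 0) {x : ℍ} (hx : axPart x ≠ 0) (y : ℍ) {z : ℍ}
    (hz : 0 < z.re) : 4 * |A.re * A.imI| * trRatio x ≤ ‖Lrel A x y z 4‖ + imRatio z := by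
  have e : Xd x * (star A - A * A * A) = Lrel A x y z 4 + radialUnit (axPart x) * Zd z * A := by
    rw [Lrel_four_eq hA hJ hK x y hz, sub_add_cancel]
  have h1 : ‖Xd x * (star A - A * A * A)‖ = 4 * |A.re * A.imI| * trRatio x := by
    rw [norm_mul, norm_star_sub_cube hA hJ hK, norm_Xd]; ring
  have h2 : ‖radialUnit (axPart x) * Zd z * A‖ = imRatio z := by
    rw [norm_mul, norm_mul, norm_radialUnit hx, hA, one_mul, mul_one, norm_Zd]
  rw [← h1, e, ← h2]
  exact norm_add_le _ _

/-! ## §42 The ratio bounds on the limit event -/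

/-- ★★ **THE LINEARISED RELATIONS BOUND THE THREE RATIOS ON THE LIMIT EVENT** (w2 g56's request): for `w = ((x,y),z) ∈ limSigma r A` with
`x̄ ≠ 0` and an axial unit hub `A = α + βi`: `c ≤ r`, `2|β|·b ≤ r`, `4|αβ|·a ≤ 2r`. [folklore] -/
theorem ratios_le_of_mem_limSigma {r : ℝ} {A : ℍ} (hA : ‖A‖ = 1) (hJ : A.imJ = 0) (hK : A.imK = 0) {w : (ℍ × ℍ) × ℍ}
    (hx : axPart w.1.1 ≠ 0) (hw : w ∈ limSigma r A) :
    imRatio w.2 ≤ r ∧ 2 * |A.imI| * trRatio w.1.2 ≤ r ∧ 4 * |A.re * A.imI| * trRatio w.1.1 ≤ 2 * r := by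
  rw [mem_limSigma_iff] at hw
  obtain ⟨hL, -, -, hz⟩ := hw
  have h3 := hL 3
  have h4 := hL 4
  have h5 := hL 5
  rw [norm_Lrel_three hA hJ hK hx w.1.2 hz] at h3
  rw [norm_Lrel_five hJ hK] at h5
  refine ⟨h3, h5, ?_⟩
  have h := trRatio_mul_le_norm_Lrel_four hA hJ hK hx w.1.2 hz
  linarith

/-- ★★ **Hence `a + b + c ≤ 2r/|αβ|` on `limSigma r A`** (`αβ ≠ 0`, `x̄ ≠ 0`): the `L`-side region `{a + b + c > R₀}` is EMPTY for
`R₀ ≥ 2r/|αβ|`, only the hub cap remains (w2 g56's plan). [folklore] -/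
theorem sum_ratios_le_of_mem_limSigma {r : ℝ} {A : ℍ} (hA : ‖A‖ = 1) (hJ : A.imJ = 0) (hK : A.imK = 0) (hαβ : A.re * A.imI ≠ 0)
    {w : (ℍ × ℍ) × ℍ} (hx : axPart w.1.1 ≠ 0) (hw : w ∈ limSigma r A) :
    trRatio w.1.1 + trRatio w.1.2 + imRatio w.2 ≤ 2 * r / |A.re * A.imI| := by
  obtain ⟨hc, hb, ha⟩ := ratios_le_of_mem_limSigma hA hJ hK hx hw
  obtain ⟨ha0, hc0⟩ := ratios_nonneg w.1.1 w.2
  have hb0 := (ratios_nonneg w.1.2 w.2).1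
  have h1 := axial_sq_add_sq hA hJ hK
  have hα : |A.re| ≤ 1 := (sq_le_one_iff_abs_le_one _).1 (by nlinarith [sq_nonneg A.imI])
  have hβ : |A.imI| ≤ 1 := (sq_le_one_iff_abs_le_one _).1 (by nlinarith [sq_nonneg A.re])
  have hp : 0 < |A.re| := abs_pos.2 (left_ne_zero_of_mul hαβ)
  have hq : 0 < |A.imI| := abs_pos.2 (right_ne_zero_of_mul hαβ)
  rw [abs_mul] at ha ⊢
  rw [le_div_iff₀ (mul_pos hp hq)]
  nlinarith [mul_nonneg (mul_nonneg hb0 hq.le) (sub_nonneg.2 hα), mul_nonneg hc0 (sub_nonneg.2 hα),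
    mul_nonneg (mul_nonneg hc0 hp.le) (sub_nonneg.2 hβ)]

end Summit.QuantumFields.YangMills.Theorems.SwapVirialDeficit.ZeroModeSigma

end
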